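import Mathlib
import Summits.ValiantsHypothesis.ValiantsHypothesis.Theses.ChowBorderDepth3
import Literature.Computability.AlgebraicComplexity.DeterminantalConormalBoundKernelAlgebra

/-!
# Stub `stub_translate` of crux `ChowBorderDepth3.ChowBorderBound` (stmt-ValiantsHypothesis-5936),
# line `registered` (vertex normal form)

This file proves the **generic translation** step of the vertex normal form for border
depth-three (`ΣΠΣ`) expressions of the padded permanent over `ℂ[ε]` (`ε = Polynomial.X`).

## Statement

Suppose `Σ_{i<r} Π_{j<D} ℓ i j = ε^q · perₙ + ε^(q+1) · G` with every `ℓ i j` an affine form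
(total degree `≤ 1`) in the variables `Fin n × Fin n` over `ℂ[ε]`.  Then there are a translation
vector `u : Fin n × Fin n → ℂ[ε]`, row weights `a i`, *non-zero* constants `c i j` and linear parts
`L i j` such that
`Σ_i C (a i) · Π_j (C (c i j) + Σ_v C (L i j v) · X v) = τ_u (ε^q · perₙ + ε^(q+1) · G)`,
where `τ_u = MvPolynomial.aeval (fun v => X v + C (u v))` is the translation by `u`.

## Proof

The translation `τ_u` is a `ℂ[ε]`-algebra endomorphism sending an affine form
`ℓ = C c + Σ_v C (L v) X v` to `C (eval u ℓ) + Σ_v C (L v) X v`: the constant term becomes the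
value `ℓ(u)` and the linear part is unchanged.  Since `MvPolynomial _ ℂ[ε]` is a domain, the
product `P` of all *non-zero* `ℓ i j` is non-zero, and function extensionality for multivariate
polynomials over the infinite domain `ℂ[ε]` (`MvPolynomial.funext`) yields a point `u` with
`eval u P ≠ 0`, hence `eval u (ℓ i j) ≠ 0` for every non-zero `ℓ i j`.  For the rows `i` in which
all `ℓ i j ≠ 0` we take `a i = 1`, `c i j = eval u (ℓ i j)` and `L i j v = coeff e_v (ℓ i j)`; for
the remaining rows the product `Π_j τ_u (ℓ i j)` vanishes and we take `a i = 0`, `c i j = 1`.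
Summing, `Σ_i C (a i) Π_j (…) = Σ_i Π_j τ_u (ℓ i j) = τ_u (Σ_i Π_j ℓ i j)`, which is `τ_u` of the
right-hand side of the hypothesis.  The exponent `q` and the error term `G` are unchanged.

## References

Folklore (generic translation of affine forms); the affine expansion is
`DeterminantalConormal.eq_C_add_sum_of_totalDegree_le_one`.
-/

noncomputable section

-- `Summit.ValiantsHypothesis.ValiantsHypothesis.…` is the tree's mandated single-conjunct layout
-- (Sub = Summit), so the duplicated namespace component is intended.
set_option linter.dupNamespace false

namespace Summit.ValiantsHypothesis.ValiantsHypothesis.Theorems.ChowBorderBound.Translate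

open MvPolynomial Literature.Computability.AlgebraicComplexity
open scoped Polynomial

/-- **Translation of an affine form.** For `p` of total degree `≤ 1`, the translation
`X v ↦ X v + C (u v)` replaces the constant term of `p` by the value `eval u p` and keeps the
linear part. -/
theorem aeval_translate_of_totalDegree_le_one {R : Type*} [CommRing R] {σ : Type*} [Fintype σ]
    (u : σ → R) {p : MvPolynomial σ R} (hp : p.totalDegree ≤ 1) :
    aeval (fun v => X v + C (u v)) p =
      C (eval u p) + ∑ v, C (coeff (Finsupp.single v 1) p) * X v := by
  rw [DeterminantalConormal.eval_eq_coeff_zero_add_sum hp u]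
  conv_lhs => rw [DeterminantalConormal.eq_C_add_sum_of_totalDegree_le_one hp]
  simp only [map_add, map_sum, map_mul, aeval_C, aeval_X, algebraMap_eq, mul_add]
  rw [Finset.sum_add_distrib]
  ring

/-- **Generic point.** Finitely many non-zero multivariate polynomials over an infinite integral
domain have a common non-root. -/
theorem exists_forall_eval_ne_zero {R : Type*} [CommRing R] [IsDomain R] [Infinite R]
    {σ ι : Type*} (s : Finset ι) (f : ι → MvPolynomial σ R) (hf : ∀ i ∈ s, f i ≠ 0) :
    ∃ u : σ → R, ∀ i ∈ s, eval u (f i) ≠ 0 := by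
  have hP : ∏ i ∈ s, f i ≠ 0 := Finset.prod_ne_zero_iff.mpr hf
  have hex : ¬ ∀ u : σ → R, eval u (∏ i ∈ s, f i) = eval u 0 := fun h => hP (MvPolynomial.funext h)
  push Not at hex
  obtain ⟨u, hu⟩ := hex
  refine ⟨u, fun i hi h0 => hu ?_⟩
  rw [map_zero, map_prod]
  exact Finset.prod_eq_zero hi h0

/-- **Stub `stub_translate`** (registered stub of crux stmt-ValiantsHypothesis-5936, line `registered`):
a border `ΣΠΣ` expression `Σ_{i<r} Π_{j<D} ℓ i j = ε^q · perₙ + ε^(q+1) · G` with affine `ℓ i j`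
over `ℂ[ε]` can be translated by a generic vector `u` into the shape
`Σ_i C (a i) · Π_j (C (c i j) + Σ_v C (L i j v) · X v)` with all constants `c i j ≠ 0`, the
right-hand side being replaced by its translate under `X v ↦ X v + C (u v)` (same `q`, same `G`). -/
theorem stub_translate :
    ∀ n r D : ℕ,
    (∃ (q : ℕ) (ℓ : Fin r → Fin D → MvPolynomial (Fin n × Fin n) (Polynomial ℂ))
        (G : MvPolynomial (Fin n × Fin n) (Polynomial ℂ)),
        (∀ i j, (ℓ i j).totalDegree ≤ 1) ∧
        (∑ i, ∏ j, ℓ i j) =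
          MvPolynomial.C (Polynomial.X ^ q) *
              MvPolynomial.map Polynomial.C
                (Literature.Computability.AlgebraicComplexity.perPoly (Fin n) ℂ) +
            MvPolynomial.C (Polynomial.X ^ (q + 1)) * G) →
    ∃ (q : ℕ) (u : Fin n × Fin n → Polynomial ℂ) (a : Fin r → Polynomial ℂ)
      (c : Fin r → Fin D → Polynomial ℂ) (L : Fin r → Fin D → Fin n × Fin n → Polynomial ℂ)
      (G : MvPolynomial (Fin n × Fin n) (Polynomial ℂ)),
      (∀ i j, c i j ≠ 0) ∧
      (∑ i, MvPolynomial.C (a i) *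
          ∏ j, (MvPolynomial.C (c i j) + ∑ v, MvPolynomial.C (L i j v) * MvPolynomial.X v)) =
        MvPolynomial.aeval (fun v => MvPolynomial.X v + MvPolynomial.C (u v))
          (MvPolynomial.C (Polynomial.X ^ q) *
              MvPolynomial.map Polynomial.C
                (Literature.Computability.AlgebraicComplexity.perPoly (Fin n) ℂ) +
            MvPolynomial.C (Polynomial.X ^ (q + 1)) * G) := by
  classical
  intro n r D
  rintro ⟨q, ℓ, G, hdeg, hsum⟩
  -- a generic translation vector: a common non-root of all non-zero `ℓ i j`
  obtain ⟨u, hu⟩ : ∃ u : Fin n × Fin n → ℂ[X], ∀ i j, ℓ i j ≠ 0 → eval u (ℓ i j) ≠ 0 := by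
    obtain ⟨u, hu⟩ := exists_forall_eval_ne_zero
      (Finset.univ.filter fun p : Fin r × Fin D => ℓ p.1 p.2 ≠ 0) (fun p => ℓ p.1 p.2)
      (fun p hp => (Finset.mem_filter.mp hp).2)
    exact ⟨u, fun i j hij => hu (i, j) (Finset.mem_filter.mpr ⟨Finset.mem_univ _, hij⟩)⟩
  refine ⟨q, u, fun i => if ∀ j, ℓ i j ≠ 0 then 1 else 0,
    fun i j => if ℓ i j ≠ 0 then eval u (ℓ i j) else 1,
    fun i j v => coeff (Finsupp.single v 1) (ℓ i j), G, ?_, ?_⟩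
  · -- the constants are non-zero
    intro i j
    dsimp only
    by_cases h : ℓ i j ≠ 0
    · rw [if_pos h]
      exact hu i j h
    · rw [if_neg h]
      exact one_ne_zero
  · -- the translated expression
    rw [← hsum, map_sum]
    refine Finset.sum_congr rfl fun i _ => ?_
    dsimp only
    rw [map_prod]
    by_cases h : ∀ j, ℓ i j ≠ 0
    · rw [if_pos h, C_1, one_mul]
      refine Finset.prod_congr rfl fun j _ => ?_
      rw [if_pos (h j), aeval_translate_of_totalDegree_le_one u (hdeg i j)]
    · rw [if_neg h, C_0, zero_mul]
      push Not at h
      obtain ⟨j, hj⟩ := h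
      exact (Finset.prod_eq_zero (Finset.mem_univ j) (by rw [hj, map_zero])).symm

end Summit.ValiantsHypothesis.ValiantsHypothesis.Theorems.ChowBorderBound.Translate

end
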